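import Literature.Analysis.FunctionSpaces.TorusFourierModes
import HarnessLib

/-!
# The Leray frame in Fourier variables: `z⁽ⁱ⁾(k) = |k|² eᵢ - kᵢ k`

Trunk: Sobolev (`Literature/Analysis/FunctionSpaces`). On `T^d` the Leray projector acts mode by
mode by the symbol `P_k = I - k ⊗ k/|k|²`: `(ℙu)^(k) = û(k) - (û(k)·k/|k|²) k`
(Robinson–Rodrigo–Sadowski 2016, Def. 2.8 and the Fourier formula that follows it; Lemma 2.9).
Weak formulations of incompressible problems test only against divergence-free fields, i.e. in
Fourier variables only against **transversal** vectors `z` (`k · z = 0`); to avoid choosing bases of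
the hyperplanes `k^⊥` we use the `d` real vectors

  `z⁽ⁱ⁾(k) = |k|² eᵢ - kᵢ k`,  `i : d`  (`Torus.lerayFrameVec k i ∈ ℂ^d`),

which are transversal and form a TIGHT FRAME of `k^⊥` scaled by `|k|⁴`:
`∑ᵢ z⁽ⁱ⁾ ⊗ z⁽ⁱ⁾ = |k|⁴ I - |k|² k ⊗ k = |k|⁴ P_k`. Everything here is proved:

* `Torus.freqVecC k` — the frequency `k` as a vector of `ℂ^d`; `‖k‖² = |k|²`,
  `⟪X, k⟫_ℂ = conj (k · X)`;
* `Torus.lerayFrameVec k i` and its coordinates; transversality `k · z⁽ⁱ⁾ = 0`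
  (`sum_mul_lerayFrameVec_eq_zero`, the form consumed by `isDivFree_realTrigPoly_singleton` and by
  `IsWeakPassiveVectorOn.ae_inner_mFourierCoeff_eq`); `z⁽ⁱ⁾(0) = 0`;
* pairings `⟪X, z⁽ⁱ⁾⟫ = |k|² conj Xᵢ - kᵢ conj (k · X)`, `= |k|² conj Xᵢ` for transversal `X`;
* the exact size `‖z⁽ⁱ⁾‖² = |k|² (|k|² - kᵢ²) ≤ |k|⁴`;
* **recovery of the norm** `∑ᵢ |⟪X, z⁽ⁱ⁾⟫|² = |k|⁴ ‖X‖²` for transversal `X`;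
* **the frame identity** `∑ᵢ ⟪z⁽ⁱ⁾, Y⟫ z⁽ⁱ⁾ = |k|⁴ Y - |k|² (k · Y) k` (`= |k|⁴ P_k Y`) for every `Y`,
  and `∑ᵢ ⟪X, z⁽ⁱ⁾⟫⟪z⁽ⁱ⁾, Y⟫ = |k|⁴ ⟪X, Y⟫` for transversal `X`.

Used by the weak passive-vector theory (`FluidPDE/PassiveVectorUniqueness`, and the vector
Fourier–Galerkin energy argument: Galerkin sums over the frame reproduce the Leray truncation).

## Mathlib / tree search

Mathlib: `EuclideanSpace.single`, `EuclideanSpace.inner_single_right`, `PiLp.norm_single`,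
`PiLp.inner_apply`, `EuclideanSpace.norm_sq_eq`; no Leray projector. Tree: `TorusLerayHelmholtz*`
(the projector on fields, not the frame), `TorusFourierModes` §SingleMode, `Torus.freqNormSq`.

## References

* J. C. Robinson, J. L. Rodrigo, W. Sadowski, *The three-dimensional Navier–Stokes equations*
  (CUP 2016), Ch. 2: Def. 2.8 (Leray projector) with the Fourier formula
  `ℙu = ∑ₖ (ûₖ - (ûₖ·k/|k|²) k) e^{ik·x}`, Lemma 2.9. [`RobinsonRodrigoSadowski2016`]
-/

noncomputable section

open Complex
open scoped InnerProductSpace ComplexConjugate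

namespace Literature.Analysis.FunctionSpaces

namespace Torus

variable {d : Type*} [Fintype d]

/-! ## The frequency vector in `ℂ^d` -/

/-- The frequency `k ∈ ℤ^d` as a vector of `ℂ^d`. [cite: RobinsonRodrigoSadowski2016, Ch. 2 Def. 2.8 (Fourier formula for the Leray projector)] -/
def freqVecC (k : d → ℤ) : EuclideanSpace ℂ d :=
  WithLp.toLp 2 (fun j : d => ((k j : ℤ) : ℂ))

omit [Fintype d] in
/-- Coordinates of `freqVecC`. [cite: RobinsonRodrigoSadowski2016, Ch. 2 Def. 2.8] -/
@[simp]
theorem freqVecC_apply (k : d → ℤ) (j : d) : freqVecC k j = ((k j : ℤ) : ℂ) := rfl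

/-- `k · k = |k|²` in `ℂ`. [cite: RobinsonRodrigoSadowski2016, Ch. 2 Def. 2.8] -/
theorem sum_mul_freqVecC (k : d → ℤ) :
    ∑ j, ((k j : ℤ) : ℂ) * freqVecC k j = ((freqNormSq k : ℝ) : ℂ) := by
  simp only [freqVecC_apply, freqNormSq]
  push_cast
  exact Finset.sum_congr rfl fun j _ => by ring

/-- `‖k‖² = |k|²`. [cite: RobinsonRodrigoSadowski2016, Ch. 2 Def. 2.8] -/
theorem norm_sq_freqVecC (k : d → ℤ) : ‖freqVecC k‖ ^ 2 = freqNormSq k := by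
  rw [EuclideanSpace.norm_sq_eq, freqNormSq]
  refine Finset.sum_congr rfl fun j _ => ?_
  rw [freqVecC_apply, Complex.norm_intCast, sq_abs]

/-- `|kᵢ| ≤ ‖k‖`. [cite: RobinsonRodrigoSadowski2016, Ch. 2 Def. 2.8] -/
theorem norm_apply_le_norm_freqVecC (k : d → ℤ) (i : d) : ‖((k i : ℤ) : ℂ)‖ ≤ ‖freqVecC k‖ := by
  have h1 : ‖((k i : ℤ) : ℂ)‖ ^ 2 ≤ ‖freqVecC k‖ ^ 2 := by
    rw [EuclideanSpace.norm_sq_eq (freqVecC k)]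
    exact Finset.single_le_sum (f := fun j => ‖freqVecC k j‖ ^ 2) (fun j _ => sq_nonneg _)
      (Finset.mem_univ i)
  exact (pow_le_pow_iff_left₀ (norm_nonneg _) (norm_nonneg _) two_ne_zero).1 h1

/-- Pairing with the frequency vector: `⟪X, k⟫_ℂ = conj (k · X)` (the inner product is conjugate
linear in its first slot). [cite: RobinsonRodrigoSadowski2016, Ch. 2 Def. 2.8] -/
theorem inner_freqVecC (k : d → ℤ) (X : EuclideanSpace ℂ d) :
    ⟪X, freqVecC k⟫_ℂ = conj (∑ j, ((k j : ℤ) : ℂ) * X j) := by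
  rw [PiLp.inner_apply, map_sum]
  refine Finset.sum_congr rfl fun j _ => ?_
  rw [RCLike.inner_apply', freqVecC_apply, map_mul, map_intCast, mul_comm]

/-- Pairing of the frequency vector with `Y`: `⟪k, Y⟫_ℂ = k · Y`. [cite: RobinsonRodrigoSadowski2016, Ch. 2 Def. 2.8] -/
theorem freqVecC_inner (k : d → ℤ) (Y : EuclideanSpace ℂ d) :
    ⟪freqVecC k, Y⟫_ℂ = ∑ j, ((k j : ℤ) : ℂ) * Y j := by
  rw [PiLp.inner_apply]
  refine Finset.sum_congr rfl fun j _ => ?_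
  rw [RCLike.inner_apply', freqVecC_apply, map_intCast]

/-! ## The frame vectors -/

section Frame

variable [DecidableEq d]

/-- **The Leray frame vector** `z⁽ⁱ⁾(k) = |k|² eᵢ - kᵢ k ∈ ℂ^d` (real entries): `|k|²` times the
`i`-th column of the Leray symbol `P_k = I - k ⊗ k/|k|²`. [cite: RobinsonRodrigoSadowski2016, Ch. 2 Def. 2.8 (Fourier formula for the Leray projector)] -/
def lerayFrameVec (k : d → ℤ) (i : d) : EuclideanSpace ℂ d :=
  ((freqNormSq k : ℝ) : ℂ) • EuclideanSpace.single i (1 : ℂ) - ((k i : ℤ) : ℂ) • freqVecC k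

/-- Coordinates: `z⁽ⁱ⁾(k)ⱼ = |k|² δᵢⱼ - kᵢ kⱼ`. [cite: RobinsonRodrigoSadowski2016, Ch. 2 Def. 2.8] -/
theorem lerayFrameVec_apply (k : d → ℤ) (i j : d) :
    lerayFrameVec k i j = ((freqNormSq k : ℝ) : ℂ) * (if j = i then 1 else 0) - ((k i : ℤ) : ℂ) * ((k j : ℤ) : ℂ) := by
  simp only [lerayFrameVec, PiLp.sub_apply, PiLp.smul_apply, PiLp.single_apply, freqVecC_apply, smul_eq_mul]

/-- The frame vectors have real entries: `conj z⁽ⁱ⁾ⱼ = z⁽ⁱ⁾ⱼ`. [cite: RobinsonRodrigoSadowski2016, Ch. 2 Def. 2.8] -/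
theorem conj_lerayFrameVec_apply (k : d → ℤ) (i j : d) :
    conj (lerayFrameVec k i j) = lerayFrameVec k i j := by
  rw [lerayFrameVec_apply, map_sub, map_mul, map_mul, Complex.conj_ofReal, map_intCast, map_intCast]
  congr 1
  split_ifs <;> simp

/-- At the zero frequency the frame vectors vanish. [cite: RobinsonRodrigoSadowski2016, Ch. 2 Def. 2.8] -/
theorem lerayFrameVec_zero (i : d) : lerayFrameVec (0 : d → ℤ) i = 0 := by
  ext j
  rw [lerayFrameVec_apply]
  simp [freqNormSq]

/-- **Transversality**: `k · z⁽ⁱ⁾(k) = ∑ⱼ kⱼ z⁽ⁱ⁾ⱼ = 0`. [cite: RobinsonRodrigoSadowski2016, Ch. 2 Def. 2.8] -/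
theorem sum_mul_lerayFrameVec_eq_zero (k : d → ℤ) (i : d) :
    ∑ j, ((k j : ℤ) : ℂ) * lerayFrameVec k i j = 0 := by
  simp_rw [lerayFrameVec_apply, mul_sub, Finset.sum_sub_distrib, mul_ite, mul_one, mul_zero,
    Finset.sum_ite_eq', Finset.mem_univ, if_true]
  have h : ∑ j, ((k j : ℤ) : ℂ) * (((k i : ℤ) : ℂ) * ((k j : ℤ) : ℂ)) =
      ((k i : ℤ) : ℂ) * ∑ j, ((k j : ℤ) : ℂ) * freqVecC k j := by
    rw [Finset.mul_sum]
    exact Finset.sum_congr rfl fun j _ => by rw [freqVecC_apply]; ring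
  rw [h, sum_mul_freqVecC]
  ring

/-- **Pairing with a frame vector**: `⟪X, z⁽ⁱ⁾⟫_ℂ = |k|² conj Xᵢ - kᵢ conj (k · X)`.
[cite: RobinsonRodrigoSadowski2016, Ch. 2 Def. 2.8] -/
theorem inner_lerayFrameVec (k : d → ℤ) (X : EuclideanSpace ℂ d) (i : d) :
    ⟪X, lerayFrameVec k i⟫_ℂ =
      ((freqNormSq k : ℝ) : ℂ) * conj (X i) - ((k i : ℤ) : ℂ) * conj (∑ j, ((k j : ℤ) : ℂ) * X j) := by
  rw [lerayFrameVec, inner_sub_right, inner_smul_right, inner_smul_right, EuclideanSpace.inner_single_right,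
    inner_freqVecC, one_mul]

/-- For a TRANSVERSAL `X` (`k · X = 0`): `⟪X, z⁽ⁱ⁾⟫_ℂ = |k|² conj Xᵢ`. [cite: RobinsonRodrigoSadowski2016, Ch. 2 Def. 2.8] -/
theorem inner_lerayFrameVec_of_sum_eq_zero (k : d → ℤ) {X : EuclideanSpace ℂ d}
    (hX : ∑ j, ((k j : ℤ) : ℂ) * X j = 0) (i : d) :
    ⟪X, lerayFrameVec k i⟫_ℂ = ((freqNormSq k : ℝ) : ℂ) * conj (X i) := by
  rw [inner_lerayFrameVec, hX, map_zero, mul_zero, sub_zero]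

/-- Pairing of a frame vector with `Y`: `⟪z⁽ⁱ⁾, Y⟫_ℂ = |k|² Yᵢ - kᵢ (k · Y)`. [cite: RobinsonRodrigoSadowski2016, Ch. 2 Def. 2.8] -/
theorem lerayFrameVec_inner (k : d → ℤ) (Y : EuclideanSpace ℂ d) (i : d) :
    ⟪lerayFrameVec k i, Y⟫_ℂ = ((freqNormSq k : ℝ) : ℂ) * Y i - ((k i : ℤ) : ℂ) * ∑ j, ((k j : ℤ) : ℂ) * Y j := by
  rw [lerayFrameVec, inner_sub_left, inner_smul_left, inner_smul_left, EuclideanSpace.inner_single_left,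
    freqVecC_inner, map_one, one_mul, Complex.conj_ofReal, map_intCast]

/-- **Exact size of the frame vectors**: `‖z⁽ⁱ⁾(k)‖² = |k|² (|k|² - kᵢ²)`. [cite: RobinsonRodrigoSadowski2016, Ch. 2 Def. 2.8] -/
theorem norm_sq_lerayFrameVec (k : d → ℤ) (i : d) :
    ‖lerayFrameVec k i‖ ^ 2 = freqNormSq k * (freqNormSq k - (k i : ℝ) ^ 2) := by
  -- `‖z‖² = Re ⟪z, z⟫ = Re (|k|² zᵢ - kᵢ (k·z)) = |k|² Re zᵢ` and `zᵢ = |k|² - kᵢ²`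
  have h1 : (‖lerayFrameVec k i‖ ^ 2 : ℝ) = (⟪lerayFrameVec k i, lerayFrameVec k i⟫_ℂ).re := by
    rw [← inner_self_eq_norm_sq (𝕜 := ℂ)]
    rfl
  rw [h1, lerayFrameVec_inner, sum_mul_lerayFrameVec_eq_zero, mul_zero, sub_zero, lerayFrameVec_apply,
    if_pos rfl, mul_one]
  simp only [Complex.mul_re, Complex.sub_re, Complex.ofReal_re, Complex.ofReal_im, Complex.sub_im,
    Complex.mul_im, Complex.intCast_re, Complex.intCast_im, mul_zero, sub_zero, zero_mul, add_zero]
  ring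

/-- `‖z⁽ⁱ⁾(k)‖ ≤ |k|²`. [cite: RobinsonRodrigoSadowski2016, Ch. 2 Def. 2.8] -/
theorem norm_lerayFrameVec_le (k : d → ℤ) (i : d) : ‖lerayFrameVec k i‖ ≤ freqNormSq k := by
  have hN := freqNormSq_nonneg k
  have h1 : ‖lerayFrameVec k i‖ ^ 2 ≤ freqNormSq k ^ 2 := by
    rw [norm_sq_lerayFrameVec]
    nlinarith [mul_nonneg hN (sq_nonneg (k i : ℝ))]
  exact (pow_le_pow_iff_left₀ (norm_nonneg _) hN two_ne_zero).1 h1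

/-- **Recovery of the norm of a transversal vector from its frame pairings**:
`∑ᵢ |⟪X, z⁽ⁱ⁾(k)⟫|² = |k|⁴ ‖X‖²` when `k · X = 0`. [cite: RobinsonRodrigoSadowski2016, Ch. 2 Def. 2.8] -/
theorem sum_norm_sq_inner_lerayFrameVec (k : d → ℤ) {X : EuclideanSpace ℂ d}
    (hX : ∑ j, ((k j : ℤ) : ℂ) * X j = 0) :
    ∑ i, ‖⟪X, lerayFrameVec k i⟫_ℂ‖ ^ 2 = freqNormSq k ^ 2 * ‖X‖ ^ 2 := by
  rw [EuclideanSpace.norm_sq_eq X, Finset.mul_sum]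
  refine Finset.sum_congr rfl fun i _ => ?_
  rw [inner_lerayFrameVec_of_sum_eq_zero k hX i, norm_mul, Complex.norm_conj, Complex.norm_real,
    Real.norm_eq_abs, abs_of_nonneg (freqNormSq_nonneg k), mul_pow]

/-- The `k`-weighted sum of the frame pairings vanishes: `∑ᵢ kᵢ ⟪z⁽ⁱ⁾, Y⟫ = 0` (the frame lies in
`k^⊥`). [cite: RobinsonRodrigoSadowski2016, Ch. 2 Def. 2.8] -/
theorem sum_mul_lerayFrameVec_inner (k : d → ℤ) (Y : EuclideanSpace ℂ d) :
    ∑ i, ((k i : ℤ) : ℂ) * ⟪lerayFrameVec k i, Y⟫_ℂ = 0 := by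
  simp_rw [lerayFrameVec_inner, mul_sub, Finset.sum_sub_distrib]
  have h1 : ∑ i, ((k i : ℤ) : ℂ) * (((freqNormSq k : ℝ) : ℂ) * Y i) =
      ((freqNormSq k : ℝ) : ℂ) * ∑ j, ((k j : ℤ) : ℂ) * Y j := by
    rw [Finset.mul_sum]
    exact Finset.sum_congr rfl fun i _ => by ring
  have h2 : ∑ i, ((k i : ℤ) : ℂ) * (((k i : ℤ) : ℂ) * ∑ j, ((k j : ℤ) : ℂ) * Y j) =
      (∑ i, ((k i : ℤ) : ℂ) * freqVecC k i) * ∑ j, ((k j : ℤ) : ℂ) * Y j := by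
    rw [Finset.sum_mul]
    exact Finset.sum_congr rfl fun i _ => by rw [freqVecC_apply]; ring
  rw [h1, h2, sum_mul_freqVecC, sub_self]

/-- **The frame identity** (`∑ᵢ z⁽ⁱ⁾ ⊗ z⁽ⁱ⁾ = |k|⁴ P_k`): for every `Y ∈ ℂ^d`,
`∑ᵢ ⟪z⁽ⁱ⁾, Y⟫ z⁽ⁱ⁾ = |k|⁴ Y - |k|² (k · Y) k`, i.e. `|k|⁴` times the Leray projection `P_k Y`.
[cite: RobinsonRodrigoSadowski2016, Ch. 2 Def. 2.8 (Fourier formula for the Leray projector)] -/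
theorem sum_inner_lerayFrameVec_smul (k : d → ℤ) (Y : EuclideanSpace ℂ d) :
    ∑ i, ⟪lerayFrameVec k i, Y⟫_ℂ • lerayFrameVec k i =
      (((freqNormSq k : ℝ) : ℂ) ^ 2) • Y -
        (((freqNormSq k : ℝ) : ℂ) * ∑ j, ((k j : ℤ) : ℂ) * Y j) • freqVecC k := by
  ext l
  simp only [PiLp.sub_apply, PiLp.smul_apply, smul_eq_mul, freqVecC_apply]
  rw [WithLp.ofLp_sum, Finset.sum_apply]
  simp only [WithLp.ofLp_smul, Pi.smul_apply, smul_eq_mul]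
  -- `(∑ᵢ ⟪zᵢ,Y⟫ zᵢ)_l = |k|² ⟪z_l, Y⟫ - k_l ∑ᵢ kᵢ ⟪zᵢ, Y⟫ = |k|² ⟪z_l, Y⟫`
  have e : ∀ i, ⟪lerayFrameVec k i, Y⟫_ℂ * lerayFrameVec k i l =
      ((freqNormSq k : ℝ) : ℂ) * (if l = i then ⟪lerayFrameVec k i, Y⟫_ℂ else 0) -
        ((k l : ℤ) : ℂ) * (((k i : ℤ) : ℂ) * ⟪lerayFrameVec k i, Y⟫_ℂ) := by
    intro i
    rw [lerayFrameVec_apply]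
    split_ifs <;> ring
  simp_rw [e, Finset.sum_sub_distrib, ← Finset.mul_sum, Finset.sum_ite_eq, Finset.mem_univ, if_true,
    sum_mul_lerayFrameVec_inner, mul_zero, sub_zero, lerayFrameVec_inner]
  ring

/-- **Galerkin pairings over the frame**: for a transversal `X` and every `Y`,
`∑ᵢ ⟪X, z⁽ⁱ⁾⟫ ⟪z⁽ⁱ⁾, Y⟫ = |k|⁴ ⟪X, Y⟫`. [cite: RobinsonRodrigoSadowski2016, Ch. 2 Def. 2.8] -/
theorem sum_inner_mul_inner_lerayFrameVec (k : d → ℤ) {X : EuclideanSpace ℂ d}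
    (hX : ∑ j, ((k j : ℤ) : ℂ) * X j = 0) (Y : EuclideanSpace ℂ d) :
    ∑ i, ⟪X, lerayFrameVec k i⟫_ℂ * ⟪lerayFrameVec k i, Y⟫_ℂ = (((freqNormSq k : ℝ) : ℂ) ^ 2) * ⟪X, Y⟫_ℂ := by
  have h : ∑ i, ⟪X, lerayFrameVec k i⟫_ℂ * ⟪lerayFrameVec k i, Y⟫_ℂ =
      ⟪X, ∑ i, ⟪lerayFrameVec k i, Y⟫_ℂ • lerayFrameVec k i⟫_ℂ := by
    rw [inner_sum]
    exact Finset.sum_congr rfl fun i _ => by rw [inner_smul_right, mul_comm]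
  rw [h, sum_inner_lerayFrameVec_smul, inner_sub_right, inner_smul_right, inner_smul_right, inner_freqVecC, hX,
    map_zero, mul_zero, sub_zero]

/-- The single real modes built on the frame, `Re (e_k • z⁽ⁱ⁾(k))`, are divergence free.
[cite: RobinsonRodrigoSadowski2016, Ch. 2 Def. 2.8] -/
theorem isDivFree_realTrigPoly_singleton_lerayFrameVec (k : d → ℤ) (i : d) :
    IsDivFree (realTrigPoly {k} (fun _ => lerayFrameVec k i)) :=
  isDivFree_realTrigPoly_singleton (sum_mul_lerayFrameVec_eq_zero k i)

end Frame

end Torus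

end Literature.Analysis.FunctionSpaces

end
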